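import Summits.Ventures.LatticeQCDFlow.Scaling.BooleanStarDriftPotential

/-!
HONEST FRAMING: exact (Metropolis-corrected) sampling algorithms for lattice gauge theory; figures
of merit are autocorrelation/cost numbers at stated couplings and volumes; no continuum-physics
claim.

# BooleanStarPoolPotential — THE LAST CORNER OF OPEN-MATH ITEM 1 (ii) ON THE HOMOGENEOUS BOOLEAN STAR, ABSTRACT HALF: AN EXPLICIT RELATIVE-DRIFT POTENTIAL
# ABOVE THE BOTTOM OF THE ONE-COPY DRIFT PASSES THE DRIFT INEQUALITY OF S9, GIVEN CLOSED-FORM CONDITIONS ON THE DRIFT ALONE (lean-2 GEN-33, ours)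

Venture-side (OURS).  Cell `lqcd-flow` (pub-lqcd), unit `pub-lqcd-lean-2-g33`, 2026-08-29.  Chapter T, file 1, on top of `BooleanStarDriftPotential` (S12; only its
integer-window helper `int_chain_le` is used).  Abstract one-dimensional setting on the integer window `[0, K]` in the language of S9/S11 (instantiated in T3 with
the one-copy chain of the homogeneous Boolean star: down-mass `q↓(B) = μ_0(b)π_b(B)`, up-mass `q↑(B) = μ_0(b̄)π_b̄(B)`, drift `m = q↑ − q↓`, gaps `g(B) = m(B) − m(B+1)`
non-negative and non-increasing, `q↓ > 0` on `[1,K]` non-decreasing with `q↓(B+1) ≤ 2q↓(B)`, `q↑ ≥ 0` non-increasing, `q↑(K) = 0`, and a bottom `B₀ ∈ [0, K−1]` with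
`m(B₀) ≥ 0 > m(B₀+1)`).

THE POTENTIAL (explicit — no recursion, no width to tune): slopes `S(B) = 0` for `B < B₀` and **`S(B) = β·(1 − q↑(B+1)/q↓(B+1)) = β·|m(B+1)|/q↓(B+1)`** for
`B₀ ≤ B ≤ K−1` (the RELATIVE drift one step up: `≈ β|B−B*|/B*` across an equilibrium pool of size `B*`, `→ β` far above it; non-decreasing, in `[0, β]`),
`φ(B₀) = 0`, `φ(B+1) − φ(B) = S(B)`.  Its one-cycle drift term above the bottom is, exactly,
`d(B) = q↓(B)S(B−1) − q↑(B)S(B) = β|m(B)|(1 − r_B) − β·r_B·g(B)`, `r_B = q↑(B)/q↓(B+1) ∈ [0,1]`: a SURPLUS `≥ β|m(B)|²/q↓(B+1)` and a LOSS `≤ β·g(B)` — at most `β`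
times the local gap, which the coupling bracket of every pair through `B` contains; at the bottom the loss is `q↑(B₀)S(B₀) = β·r_{B₀}·|m(B₀+1)|`.  So, in the budget
form of S11, the drift inequality reduces to (Q0) `β·q↑(B₀) ≤ q↓(B₀+1)/2`, (Q2a) `g ≥ 8ρ` on a "pool zone" `[B₀, Bp]`, and beyond it (Q2b) `2ρB·q↓(B+1) ≤
β|m(B)|(q↓(B+1) − q↑(B))` (`B ≤ K−1`), (Q2c) `2ρK ≤ β|m(K)|` — conditions on the drift alone, verified for the homogeneous Boolean star in T2
(`Bp = ⌊2μ_0(b̄)rrK/μ_0(b)⌋`, `ρ = μ_0(b)c/(96(h+2t))`, `β = 1/6`, under `rr ≤ μ_0(b)`, `μ_0(b̄)rrK ≥ μ_0(b)/2`).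

* §1 `int_gap_sum_ge'` (sum of non-increasing gaps ≥ count × last gap; window form mentioning no value beyond `hi`),
  **`relDrift_phi`** (the potential vanishes at and below the bottom; slopes in `[0, β]`, non-decreasing; `0 ≤ φ(B) ≤ min{β(B−B₀), (B−B₀)S(B−1)}` above).
* §2 **`relDrift_pointwise`** — the per-count budget `ρφ(B) − d(B)`: `= 0` below the bottom, `≤ |m(B₀+1)|/2` at it, `≤ ρβ + βg(B₀+1)` one above, `≤ βg(B)` on the pool
  zone (the surplus pays `ρφ` because `|m(B)| ≥ (B−B₀−1)·8ρ ≥ 4ρ(B−B₀)`), `≤ βg(B) − ρB` beyond, `≤ 0` resp. `≤ −ρK` at `B = K`.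
* (next file, `BooleanStarPoolDrift`) `oneCopyDrift_of_relativeDriftPotential` — the drift inequality of S9 itself for this potential, for all integers
  `0 ≤ B₁ < B₂ ≤ K`, by four cases on the positions of the two copies relative to the bottom, from the per-count budget of this file; `0 < β ≤ 1/6`.

Toy value of the same potential (work-gen33/numerics/explicit_potential.py, pure python, seconds; NOTHING CLAIMED): with `β = 1/6` the inequality holds with
`κ ≥ 0.75` in units `μ_0(b)c/(h+2t)` over 23 parameter sets (`K ≤ 800`, `μ_0(b) ∈ [0.01, 0.8]`, all `t/h`); the typed constant of T2/T3 is `1/96`.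
NOT CLAIMED: (Q0), (Q2a–c) for the explicit chain (T2); anything measured.  Literature grade (cell rule): OWN, elementary; nothing cited as a fact; no new bib keys.
-/

noncomputable section

namespace Summit.Ventures.LatticeQCDFlow.Scaling

/-! ## §1 Window bookkeeping and the shape of the potential -/

/-- Sum of gaps over a window is at least the number of gaps times the last one, for gaps non-increasing on `[lo, hi−1]` (hypothesis stated with `B + 2 ≤ hi`, so that
no value of `f` beyond `hi` is mentioned): `(B₂ − B₁)·(f(B₂−1) − f(B₂)) ≤ f(B₁) − f(B₂)` for `lo ≤ B₁ < B₂ ≤ hi`. [ours] -/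
theorem int_gap_sum_ge' {f : ℤ → ℝ} {lo hi : ℤ} (hga : ∀ B, lo ≤ B → B + 2 ≤ hi → f (B + 1) - f (B + 2) ≤ f B - f (B + 1))
    {B₁ B₂ : ℤ} (hlo : lo ≤ B₁) (h12 : B₁ < B₂) (hhi : B₂ ≤ hi) :
    ((B₂ : ℝ) - B₁) * (f (B₂ - 1) - f B₂) ≤ f B₁ - f B₂ := by
  obtain ⟨n, rfl⟩ : ∃ n : ℕ, B₂ = B₁ + 1 + n := ⟨(B₂ - B₁ - 1).toNat, by rw [Int.toNat_of_nonneg (by linarith)]; ring⟩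
  induction n with
  | zero => push_cast; rw [show B₁ + 1 + (0 : ℤ) - 1 = B₁ by ring, show B₁ + 1 + (0 : ℤ) = B₁ + 1 by ring]; ring_nf; linarith
  | succ k ih =>
    have hk : B₁ + 1 + (k : ℕ) ≤ hi := by push_cast at hhi ⊢; linarith
    have ih' := ih (by linarith) hk
    have step := hga (B₁ + k) (by linarith) (by push_cast at hhi; linarith)
    push_cast at ih' step hhi ⊢
    rw [show B₁ + 1 + (k : ℤ) - 1 = B₁ + k by ring, show B₁ + 1 + (k : ℤ) = B₁ + k + 1 by ring] at ih'
    rw [show B₁ + 1 + ((k : ℤ) + 1) - 1 = B₁ + k + 1 by ring, show B₁ + 1 + ((k : ℤ) + 1) = B₁ + k + 2 by ring]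
    have hk0 : (0 : ℝ) ≤ k + 1 := by positivity
    nlinarith [ih', step, hk0]

/-- **THE SHAPE OF THE RELATIVE-DRIFT POTENTIAL.**  On the window `[0, K]` with `q↓ > 0` on `[1, K]` non-decreasing, `q↑ ≥ 0` non-increasing, `q↑ ≤ q↓` on `[B₀+1, K]`
(`0 ≤ B₀ ≤ K−1`), slopes `S(B) = 0` (`B < B₀`), `S(B) = β(1 − q↑(B+1)/q↓(B+1))` (`B₀ ≤ B ≤ K−1`), `β ≥ 0`, and `φ(B+1) − φ(B) = S(B)`, `φ(B₀) = 0`: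
(i) `φ(B) = 0` for `B ≤ B₀`; (ii) `0 ≤ S(B) ≤ β` on `[B₀, K−1]`; (iii) `S(B) ≤ S(B+1)` on `[B₀, K−2]`; (iv) for `B₀+1 ≤ B ≤ K`:
`0 ≤ φ(B) ≤ β(B − B₀)` and `φ(B) ≤ (B − B₀)·S(B−1)`. [ours] -/
theorem relDrift_phi {qd qu S φ : ℤ → ℝ} {K B₀ : ℤ} {β : ℝ} (hβ0 : 0 ≤ β)
    (hqdpos : ∀ B, 1 ≤ B → B ≤ K → 0 < qd B) (hqu0 : ∀ B, 0 ≤ B → B ≤ K → 0 ≤ qu B)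
    (hqdmono : ∀ B, 0 ≤ B → B + 1 ≤ K → qd B ≤ qd (B + 1)) (hqumono : ∀ B, 0 ≤ B → B + 1 ≤ K → qu (B + 1) ≤ qu B)
    (hB0 : 0 ≤ B₀) (hB0K : B₀ + 1 ≤ K) (hle : ∀ B, B₀ + 1 ≤ B → B ≤ K → qu B ≤ qd B)
    (hSlo : ∀ B, B < B₀ → S B = 0) (hSmid : ∀ B, B₀ ≤ B → B + 1 ≤ K → S B = β * (1 - qu (B + 1) / qd (B + 1)))
    (hφS : ∀ B, φ (B + 1) - φ B = S B) (hφ0 : φ B₀ = 0) :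
    (∀ B, B ≤ B₀ → φ B = 0) ∧ (∀ B, B₀ ≤ B → B + 1 ≤ K → 0 ≤ S B ∧ S B ≤ β) ∧ (∀ B, B₀ ≤ B → B + 2 ≤ K → S B ≤ S (B + 1))
      ∧ (∀ B, B₀ + 1 ≤ B → B ≤ K → 0 ≤ φ B ∧ φ B ≤ β * ((B : ℝ) - B₀) ∧ φ B ≤ ((B : ℝ) - B₀) * S (B - 1)) := by
  -- (i) below the bottom
  have low : ∀ B, B ≤ B₀ → φ B = 0 := by
    intro B hB
    obtain ⟨n, rfl⟩ : ∃ n : ℕ, B = B₀ - n := ⟨(B₀ - B).toNat, by rw [Int.toNat_of_nonneg (by linarith)]; ring⟩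
    induction n with
    | zero => simpa using hφ0
    | succ k ih =>
      have e := hφS (B₀ - (k + 1))
      have z := hSlo (B₀ - (k + 1)) (by linarith)
      rw [show B₀ - ((k : ℤ) + 1) + 1 = B₀ - k by ring, ih (by linarith), z] at e
      push_cast; linarith
  -- (ii) the slopes lie in `[0, β]`
  have rng : ∀ B, B₀ ≤ B → B + 1 ≤ K → 0 ≤ S B ∧ S B ≤ β := by
    intro B hB hBK
    have hq := hqdpos (B + 1) (by linarith) hBK
    have hu := hqu0 (B + 1) (by linarith) hBK
    have hl := hle (B + 1) (by linarith) hBK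
    rw [hSmid B hB hBK]
    have r0 : 0 ≤ qu (B + 1) / qd (B + 1) := div_nonneg hu hq.le
    have r1 : qu (B + 1) / qd (B + 1) ≤ 1 := by rw [div_le_one hq]; exact hl
    have p0 := mul_nonneg hβ0 r0
    have p1 := mul_nonneg hβ0 (sub_nonneg.mpr r1)
    constructor <;> linarith
  -- (iii) the slopes do not decrease
  have mono : ∀ B, B₀ ≤ B → B + 2 ≤ K → S B ≤ S (B + 1) := by
    intro B hB hBK
    rw [hSmid B hB (by linarith), hSmid (B + 1) (by linarith) (by linarith)]
    have hq1 := hqdpos (B + 1) (by linarith) (by linarith)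
    have hq2 := hqdpos (B + 1 + 1) (by linarith) (by linarith)
    have hu2 := hqu0 (B + 1 + 1) (by linarith) (by linarith)
    have a := hqdmono (B + 1) (by linarith) (by linarith)
    have b := hqumono (B + 1) (by linarith) (by linarith)
    have key : qu (B + 1 + 1) / qd (B + 1 + 1) ≤ qu (B + 1) / qd (B + 1) := by
      rw [div_le_div_iff₀ hq2 hq1]
      calc qu (B + 1 + 1) * qd (B + 1) ≤ qu (B + 1) * qd (B + 1) := mul_le_mul_of_nonneg_right b hq1.le
        _ ≤ qu (B + 1) * qd (B + 1 + 1) := mul_le_mul_of_nonneg_left a (le_trans hu2 b)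
    have := mul_le_mul_of_nonneg_left key hβ0
    linarith
  refine ⟨low, rng, mono, ?_⟩
  -- (iv) by induction from `φ(B₀+1) = S(B₀)`
  intro B hB hBK
  obtain ⟨n, rfl⟩ : ∃ n : ℕ, B = B₀ + 1 + n := ⟨(B - B₀ - 1).toNat, by rw [Int.toNat_of_nonneg (by linarith)]; ring⟩
  induction n with
  | zero =>
    have e := hφS B₀
    rw [hφ0] at e
    obtain ⟨s0, s1⟩ := rng B₀ le_rfl hB0K
    have h1 : B₀ + 1 + ((0 : ℕ) : ℤ) = B₀ + 1 := by simp
    rw [h1, show B₀ + 1 - 1 = B₀ by ring]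
    push_cast
    rw [show (B₀ : ℝ) + 1 - B₀ = 1 by ring]
    refine ⟨by linarith, by linarith, by linarith⟩
  | succ k ih =>
    have hk : B₀ + 1 + (k : ℕ) ≤ K := by push_cast at hBK ⊢; linarith
    obtain ⟨i0, i1, i2⟩ := ih (by linarith) hk
    have e := hφS (B₀ + 1 + k)
    obtain ⟨s0, s1⟩ := rng (B₀ + 1 + k) (by linarith) (by push_cast at hBK; linarith)
    have mo := mono (B₀ + k) (by linarith) (by push_cast at hBK; linarith)
    push_cast at i0 i1 i2 e ⊢
    rw [show B₀ + 1 + (k : ℤ) - 1 = B₀ + k by ring] at i2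
    rw [show B₀ + 1 + ((k : ℤ) + 1) = B₀ + 1 + k + 1 by ring, show B₀ + 1 + (k : ℤ) + 1 - 1 = B₀ + 1 + k by ring]
    rw [show B₀ + (k : ℤ) + 1 = B₀ + 1 + k by ring] at mo
    have hk0 : (0 : ℝ) ≤ k := Nat.cast_nonneg _
    refine ⟨by linarith, by linarith, ?_⟩
    have pm := mul_le_mul_of_nonneg_left mo (by linarith : (0 : ℝ) ≤ k + 1)
    linarith [i2, pm, e]

/-! ## §2 The per-count budget -/

/-- **THE PER-COUNT BUDGET OF THE RELATIVE-DRIFT POTENTIAL.**  Setting of `relDrift_phi` plus: `m = q↑ − q↓`, gaps `g(B) = m(B) − m(B+1) ≥ 0` on `[0, K−1]` and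
non-increasing, `q↓(B+1) ≤ 2q↓(B)` on `[1, K−1]`, `q↑(K) = 0`, `m(B₀+1) < 0` (so `m < 0` on `[B₀+1, K]`), `0 < β ≤ 1`, `ρ ≥ 0`, (Q0) `βq↑(B₀) ≤ q↓(B₀+1)/2`,
a pool threshold `Bp ≥ B₀` with (Q2a) `g ≥ 8ρ` on `[B₀, Bp] ∩ [0, K−1]`, (Q2b) `2ρB·q↓(B+1) ≤ β|m(B)|(q↓(B+1) − q↑(B))` on `[Bp+1, K−1]`, (Q2c) `2ρK ≤ β|m(K)|` if
`Bp+1 ≤ K`.  Writing `d(B) = q↓(B)S(B−1) − q↑(B)S(B)`, the deficit `ρφ(B) − d(B)` is: `= 0` for `0 ≤ B ≤ B₀−1`; `≤ |m(B₀+1)|/2` at `B₀`; `≤ ρβ + βg(B₀+1)` at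
`B₀+1 ≤ K−1` and `≤ ρβ` if `B₀+1 = K`; `≤ βg(B)` for `B₀+2 ≤ B ≤ min{Bp, K−1}` (pool zone) and `≤ βg(B) − ρB` for `max{B₀+2, Bp+1} ≤ B ≤ K−1` (beyond); and the
same with `g(B−1)` in place of `g(B)` up to `B = K` included (`g(B) ≤ g(B−1)`; at `B = K` the deficit is `≤ 0`, resp. `≤ −ρK`). [ours] -/
theorem relDrift_pointwise {m qd qu S φ : ℤ → ℝ} {K B₀ Bp : ℤ} {β ρ : ℝ} (hβ0 : 0 < β) (hβ1 : β ≤ 1) (hρ : 0 ≤ ρ)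
    (hm : ∀ B, m B = qu B - qd B)
    (hqdpos : ∀ B, 1 ≤ B → B ≤ K → 0 < qd B) (hqu0 : ∀ B, 0 ≤ B → B ≤ K → 0 ≤ qu B)
    (hqdmono : ∀ B, 0 ≤ B → B + 1 ≤ K → qd B ≤ qd (B + 1)) (hqd2 : ∀ B, 1 ≤ B → B + 1 ≤ K → qd (B + 1) ≤ 2 * qd B)
    (hqumono : ∀ B, 0 ≤ B → B + 1 ≤ K → qu (B + 1) ≤ qu B) (hquK : qu K = 0)
    (hg0 : ∀ B, 0 ≤ B → B + 1 ≤ K → m (B + 1) ≤ m B)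
    (hga : ∀ B, 0 ≤ B → B + 2 ≤ K → m (B + 1) - m (B + 2) ≤ m B - m (B + 1))
    (hB0 : 0 ≤ B₀) (hB0K : B₀ + 1 ≤ K) (hmB1 : m (B₀ + 1) < 0)
    (hSlo : ∀ B, B < B₀ → S B = 0) (hSmid : ∀ B, B₀ ≤ B → B + 1 ≤ K → S B = β * (1 - qu (B + 1) / qd (B + 1)))
    (hφS : ∀ B, φ (B + 1) - φ B = S B) (hφ0 : φ B₀ = 0)
    (Q0 : β * qu B₀ ≤ qd (B₀ + 1) / 2)
    (Q2a : ∀ B, B₀ ≤ B → B ≤ Bp → B + 1 ≤ K → 8 * ρ ≤ m B - m (B + 1))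
    (Q2b : ∀ B, Bp + 1 ≤ B → B + 1 ≤ K → 2 * ρ * B * qd (B + 1) ≤ β * (-m B) * (qd (B + 1) - qu B))
    (Q2c : Bp + 1 ≤ K → 2 * ρ * K ≤ β * (-m K)) :
    (∀ B, 0 ≤ B → B + 1 ≤ B₀ → ρ * φ B - (qd B * S (B - 1) - qu B * S B) = 0)
    ∧ (ρ * φ B₀ - (qd B₀ * S (B₀ - 1) - qu B₀ * S B₀) ≤ (-m (B₀ + 1)) / 2)
    ∧ (B₀ + 2 ≤ K → ρ * φ (B₀ + 1) - (qd (B₀ + 1) * S (B₀ + 1 - 1) - qu (B₀ + 1) * S (B₀ + 1)) ≤ ρ * β + β * (m (B₀ + 1) - m (B₀ + 2)))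
    ∧ (B₀ + 1 = K → ρ * φ K - (qd K * S (K - 1) - qu K * S K) ≤ ρ * β)
    ∧ (∀ B, B₀ + 2 ≤ B → B ≤ Bp → B + 1 ≤ K → ρ * φ B - (qd B * S (B - 1) - qu B * S B) ≤ β * (m B - m (B + 1)))
    ∧ (∀ B, B₀ + 2 ≤ B → Bp + 1 ≤ B → B + 1 ≤ K → ρ * φ B - (qd B * S (B - 1) - qu B * S B) ≤ β * (m B - m (B + 1)) - ρ * B)
    ∧ (∀ B, B₀ + 2 ≤ B → B ≤ Bp → B ≤ K → ρ * φ B - (qd B * S (B - 1) - qu B * S B) ≤ β * (m (B - 1) - m B))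
    ∧ (∀ B, B₀ + 2 ≤ B → Bp + 1 ≤ B → B ≤ K → ρ * φ B - (qd B * S (B - 1) - qu B * S B) ≤ β * (m (B - 1) - m B) - ρ * B) := by
  -- signs of the drift
  have mK : ∀ B B', 0 ≤ B → B ≤ B' → B' ≤ K → m B' ≤ m B := fun B B' h0 hBB' hK =>
    int_chain_le (f := m) (lo := 0) (hi := K - 1) (fun X hX hX' => hg0 X hX (by linarith)) h0 hBB' (by linarith)
  have hneg : ∀ B, B₀ + 1 ≤ B → B ≤ K → m B < 0 := fun B hB hBK => lt_of_le_of_lt (mK (B₀ + 1) B (by linarith) hB hBK) hmB1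
  have hle : ∀ B, B₀ + 1 ≤ B → B ≤ K → qu B ≤ qd B := fun B hB hBK => by have := hneg B hB hBK; rw [hm] at this; linarith
  obtain ⟨low, rng, -, phi⟩ := relDrift_phi hβ0.le hqdpos hqu0 hqdmono hqumono hB0 hB0K hle hSlo hSmid hφS hφ0
  -- `q↓(B)·S(B−1) = β·|m(B)|` for `B₀+1 ≤ B ≤ K`
  have eS : ∀ B, B₀ + 1 ≤ B → B ≤ K → qd B * S (B - 1) = β * (-m B) := by
    intro B hB hBK
    have hq := hqdpos B (by linarith) hBK
    rw [hSmid (B - 1) (by linarith) (by linarith), sub_add_cancel, hm]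
    field_simp
    ring
  -- the loss term times the next down-mass: `q↑(B)S(B)·q↓(B+1) = β q↑(B) |m(B+1)|` for `B₀ ≤ B ≤ K−1`
  have eL : ∀ B, B₀ ≤ B → B + 1 ≤ K → qu B * S B * qd (B + 1) = β * qu B * (-m (B + 1)) := by
    intro B hB hBK
    have hq := hqdpos (B + 1) (by linarith) hBK
    rw [hSmid B hB hBK, hm]
    field_simp
    ring
  -- `|m(B)| ≥ 4ρ(B − B₀)` for `B₀ + 2 ≤ B ≤ K` in the pool zone (`B − 1 ≤ Bp`)
  have big : ∀ B, B₀ + 2 ≤ B → B - 1 ≤ Bp → B ≤ K → 4 * ρ * ((B : ℝ) - B₀) ≤ -m B := by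
    intro B hB hBp hBK
    have s := int_gap_sum_ge' (f := m) (lo := 0) (hi := K) hga (by linarith : 0 ≤ B₀ + 1) (by linarith : B₀ + 1 < B) hBK
    have gl := Q2a (B - 1) (by linarith) hBp (by linarith)
    rw [show B - 1 + 1 = B by ring] at gl
    have hBB : ((B₀ : ℝ) + 2 ≤ B) := by exact_mod_cast hB
    have hm01 : 0 ≤ -m (B₀ + 1) := by linarith
    push_cast at s
    have p1 := mul_le_mul_of_nonneg_left gl (by linarith : (0 : ℝ) ≤ (B : ℝ) - (B₀ + 1))
    have p2 := mul_nonneg hρ (by linarith : (0 : ℝ) ≤ (B : ℝ) - B₀ - 2)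
    linarith [s, p1, p2, hm01]

  -- the pool zone, `B + 1 ≤ K`: the surplus pays `ρφ`, the loss is `≤ βg(B)`
  have core3 : ∀ B, B₀ + 2 ≤ B → B ≤ Bp → B + 1 ≤ K → ρ * φ B - (qd B * S (B - 1) - qu B * S B) ≤ β * (m B - m (B + 1)) := by
    intro B hB hBp hBK1
    obtain ⟨-, -, f2⟩ := phi B (by linarith) (by linarith)
    have hq := hqdpos B (by linarith) (by linarith)
    have hq1 := hqdpos (B + 1) (by linarith) hBK1
    have e1 := eS B (by linarith) (by linarith)
    have e2 := eL B (by linarith) hBK1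
    have hmB : 0 ≤ -m B := by linarith [hneg B (by linarith) (by linarith)]
    have r1 : qu B ≤ qd (B + 1) := le_trans (hle B (by linarith) (by linarith)) (hqdmono B (by linarith) hBK1)
    have two := hqd2 B (by linarith) hBK1
    have bg := big B hB (by linarith) (by linarith)
    obtain ⟨s0, -⟩ := rng (B - 1) (by linarith) (by linarith)
    have hBB : (0 : ℝ) ≤ (B : ℝ) - B₀ := by
      have : ((B₀ : ℝ) + 2 ≤ B) := by exact_mod_cast hB
      linarith
    -- multiply the claim by `q↓(B+1) > 0`
    have key : (ρ * φ B - (qd B * S (B - 1) - qu B * S B)) * qd (B + 1) ≤ β * (m B - m (B + 1)) * qd (B + 1) := by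
      have x1 : ρ * φ B * qd (B + 1) ≤ ρ * (((B : ℝ) - B₀) * S (B - 1)) * qd (B + 1) :=
        mul_le_mul_of_nonneg_right (mul_le_mul_of_nonneg_left f2 hρ) hq1.le
      -- `S(B−1) q↓(B+1) ≤ 2 S(B−1) q↓(B) = 2β|m(B)|`
      have x2 : S (B - 1) * qd (B + 1) ≤ 2 * (β * (-m B)) := by
        have := mul_le_mul_of_nonneg_left two s0; linarith [e1]
      have x3 : ρ * (((B : ℝ) - B₀) * S (B - 1)) * qd (B + 1) ≤ 2 * ρ * ((B : ℝ) - B₀) * (β * (-m B)) := by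
        have := mul_le_mul_of_nonneg_left x2 (mul_nonneg hρ hBB); linarith
      -- `2ρ(B−B₀)·β|m| ≤ β|m|·(q↓(B+1) − q↑(B))` since `q↓(B+1) − q↑(B) ≥ |m(B)| ≥ 4ρ(B−B₀)`
      have x4 : 2 * ρ * ((B : ℝ) - B₀) * (β * (-m B)) ≤ β * (-m B) * (qd (B + 1) - qu B) := by
        have d1 : -m B ≤ qd (B + 1) - qu B := by rw [hm]; linarith [hqdmono B (by linarith) hBK1]
        have c1 : 2 * ρ * ((B : ℝ) - B₀) ≤ qd (B + 1) - qu B := by have := mul_nonneg hρ hBB; linarith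
        have := mul_le_mul_of_nonneg_left c1 (mul_nonneg hβ0.le hmB)
        linarith
      -- the loss `β q↑(B) g(B) ≤ β q↓(B+1) g(B)`
      have g0 : 0 ≤ m B - m (B + 1) := by linarith [hg0 B (by linarith) hBK1]
      have x5 : β * qu B * (m B - m (B + 1)) ≤ β * qd (B + 1) * (m B - m (B + 1)) :=
        mul_le_mul_of_nonneg_right (mul_le_mul_of_nonneg_left r1 hβ0.le) g0
      have expand : (ρ * φ B - (qd B * S (B - 1) - qu B * S B)) * qd (B + 1)
          = ρ * φ B * qd (B + 1) - β * (-m B) * (qd (B + 1) - qu B) + β * qu B * (m B - m (B + 1)) := by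
        have : (ρ * φ B - (qd B * S (B - 1) - qu B * S B)) * qd (B + 1)
            = ρ * φ B * qd (B + 1) - (qd B * S (B - 1)) * qd (B + 1) + qu B * S B * qd (B + 1) := by ring
        rw [this, e1, e2]; ring
      linarith [expand, x1, x3, x4, x5]
    exact le_of_mul_le_mul_right key hq1
  -- beyond the pool, `B + 1 ≤ K`: the surplus pays `ρφ` AND `ρB` (Q2b), the loss is `≤ βg(B)`
  have core4 : ∀ B, B₀ + 2 ≤ B → Bp + 1 ≤ B → B + 1 ≤ K → ρ * φ B - (qd B * S (B - 1) - qu B * S B) ≤ β * (m B - m (B + 1)) - ρ * B := by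
    intro B hB hBp hBK1
    obtain ⟨-, f1, -⟩ := phi B (by linarith) (by linarith)
    have hBr : β * ((B : ℝ) - B₀) ≤ B := by
      have h0 : ((0 : ℝ) ≤ B₀) := by exact_mod_cast hB0
      have hBB : (0 : ℝ) ≤ (B : ℝ) - B₀ := by
        have : ((B₀ : ℝ) + 2 ≤ B) := by exact_mod_cast hB
        linarith
      have := mul_le_mul_of_nonneg_right hβ1 hBB
      linarith
    have x1 : ρ * φ B ≤ ρ * B := mul_le_mul_of_nonneg_left (le_trans f1 hBr) hρ
    have hq1 := hqdpos (B + 1) (by linarith) hBK1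
    have e1 := eS B (by linarith) (by linarith)
    have e2 := eL B (by linarith) hBK1
    have r1 : qu B ≤ qd (B + 1) := le_trans (hle B (by linarith) (by linarith)) (hqdmono B (by linarith) hBK1)
    have q2 := Q2b B hBp hBK1
    have key : (ρ * φ B - (qd B * S (B - 1) - qu B * S B)) * qd (B + 1) ≤ (β * (m B - m (B + 1)) - ρ * B) * qd (B + 1) := by
      have x1' : ρ * φ B * qd (B + 1) ≤ ρ * B * qd (B + 1) := mul_le_mul_of_nonneg_right x1 hq1.le
      have g0 : 0 ≤ m B - m (B + 1) := by linarith [hg0 B (by linarith) hBK1]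
      have x5 : β * qu B * (m B - m (B + 1)) ≤ β * qd (B + 1) * (m B - m (B + 1)) :=
        mul_le_mul_of_nonneg_right (mul_le_mul_of_nonneg_left r1 hβ0.le) g0
      have expand : (ρ * φ B - (qd B * S (B - 1) - qu B * S B)) * qd (B + 1)
          = ρ * φ B * qd (B + 1) - β * (-m B) * (qd (B + 1) - qu B) + β * qu B * (m B - m (B + 1)) := by
        have : (ρ * φ B - (qd B * S (B - 1) - qu B * S B)) * qd (B + 1)
            = ρ * φ B * qd (B + 1) - (qd B * S (B - 1)) * qd (B + 1) + qu B * S B * qd (B + 1) := by ring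
        rw [this, e1, e2]; ring
      linarith [expand, x1', x5, q2]
    exact le_of_mul_le_mul_right key hq1
  -- the previous gap dominates the local one
  have ga : ∀ B, 1 ≤ B → B + 1 ≤ K → m B - m (B + 1) ≤ m (B - 1) - m B := fun B hB hBK => by
    have := hga (B - 1) (by linarith) (by linarith)
    rwa [sub_add_cancel, show B - 1 + 2 = B + 1 by ring] at this
  refine ⟨?_, ?_, ?_, ?_, core3, core4, ?_, ?_⟩
  · ---------------------------------------------------------------- below the bottom: everything vanishes
    intro B hB hBB
    rw [low B (by linarith), hSlo (B - 1) (by linarith), hSlo B (by linarith)]; ring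
  · ---------------------------------------------------------------- at the bottom: `q↑(B₀)S(B₀) ≤ |m(B₀+1)|/2` by (Q0)
    rw [low B₀ le_rfl, hSlo (B₀ - 1) (by linarith)]
    have hq := hqdpos (B₀ + 1) (by linarith) hB0K
    have e := eL B₀ le_rfl hB0K
    have hm1 : 0 ≤ -m (B₀ + 1) := by linarith
    have key : qu B₀ * S B₀ * qd (B₀ + 1) ≤ (-m (B₀ + 1)) / 2 * qd (B₀ + 1) := by
      rw [e]
      have := mul_le_mul_of_nonneg_right Q0 hm1
      linarith
    have := le_of_mul_le_mul_right key hq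
    linarith
  · ---------------------------------------------------------------- one above the bottom, `B₀ + 2 ≤ K`
    intro hK2
    rw [show B₀ + 1 - 1 = B₀ by ring]
    obtain ⟨-, f1, -⟩ := phi (B₀ + 1) le_rfl (by linarith)
    have hq2 := hqdpos (B₀ + 2) (by linarith) hK2
    have e1 : qd (B₀ + 1) * S B₀ = β * (-m (B₀ + 1)) := by
      have := eS (B₀ + 1) le_rfl (by linarith); rwa [show B₀ + 1 - 1 = B₀ by ring] at this
    have e2 := eL (B₀ + 1) (by linarith) (by linarith)
    rw [show B₀ + 1 + 1 = B₀ + 2 by ring] at e2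
    have a := hqdmono (B₀ + 1) (by linarith) (by linarith)
    rw [show B₀ + 1 + 1 = B₀ + 2 by ring] at a
    have r1 : qu (B₀ + 1) ≤ qd (B₀ + 2) := le_trans (hle (B₀ + 1) le_rfl (by linarith)) a
    have hm2 : 0 ≤ -m (B₀ + 2) := by linarith [hneg (B₀ + 2) (by linarith) hK2]
    have key : qu (B₀ + 1) * S (B₀ + 1) * qd (B₀ + 2) ≤ β * (-m (B₀ + 2)) * qd (B₀ + 2) := by
      rw [e2]
      have := mul_le_mul_of_nonneg_left r1 (mul_nonneg hβ0.le hm2)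
      linarith
    have l1 := le_of_mul_le_mul_right key hq2
    have f1' : ρ * φ (B₀ + 1) ≤ ρ * β := by
      have e3 : (((B₀ + 1 : ℤ) : ℝ) - B₀) = 1 := by push_cast; ring
      rw [e3, mul_one] at f1
      exact mul_le_mul_of_nonneg_left f1 hρ
    linarith [l1, f1', e1]
  · ---------------------------------------------------------------- one above the bottom, `B₀ + 1 = K`
    intro hK1
    rw [hquK, zero_mul, sub_zero]
    obtain ⟨-, f1, -⟩ := phi K (by linarith) le_rfl
    have e1 := eS K (by linarith) le_rfl
    have hmK : 0 ≤ -m K := by linarith [hneg K (by linarith) le_rfl]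
    have f1' : ρ * φ K ≤ ρ * β := by
      have e3 : ((K : ℝ) - B₀) = 1 := by rw [← hK1]; push_cast; ring
      rw [e3, mul_one] at f1
      exact mul_le_mul_of_nonneg_left f1 hρ
    have := mul_nonneg hβ0.le hmK
    linarith [f1', e1]
  · ---------------------------------------------------------------- pool zone up to `B = K`, in terms of the previous gap
    intro B hB hBp hBK
    have gprev : 0 ≤ m (B - 1) - m B := by have := hg0 (B - 1) (by linarith) (by linarith); rw [sub_add_cancel] at this; linarith
    rcases lt_or_eq_of_le hBK with hBK' | hBK'
    · have c := core3 B hB hBp (by linarith)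
      have := mul_le_mul_of_nonneg_left (ga B (by linarith) (by linarith)) hβ0.le
      linarith
    · -- `B = K`: `ρφ(K) ≤ ρβ(K−B₀) ≤ β|m(K)|/4 ≤ β|m(K)| = q↓(K)S(K−1)`
      subst hBK'
      rw [hquK, zero_mul, sub_zero]
      obtain ⟨-, -, f2⟩ := phi B (by linarith) le_rfl
      have hq := hqdpos B (by linarith) le_rfl
      have e1 := eS B (by linarith) le_rfl
      have bg := big B hB (by linarith) le_rfl
      have mKe : -m B = qd B := by rw [hm, hquK]; ring
      have x2 : qd B * S (B - 1) = qd B * β := by rw [e1, mKe]; ring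
      have x3 : S (B - 1) = β := mul_left_cancel₀ hq.ne' x2
      rw [x3] at f2
      have x1 : ρ * φ B ≤ ρ * (((B : ℝ) - B₀) * β) := mul_le_mul_of_nonneg_left f2 hρ
      have h := mul_le_mul_of_nonneg_left bg (by linarith : (0 : ℝ) ≤ β / 4)
      have hmK : 0 ≤ -m B := by rw [mKe]; exact hq.le
      have := mul_nonneg hβ0.le hmK
      have := mul_nonneg hβ0.le gprev
      linarith [x1, h, e1]
  · ---------------------------------------------------------------- beyond the pool up to `B = K`, in terms of the previous gap
    intro B hB hBp hBK
    have gprev : 0 ≤ m (B - 1) - m B := by have := hg0 (B - 1) (by linarith) (by linarith); rw [sub_add_cancel] at this; linarith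
    rcases lt_or_eq_of_le hBK with hBK' | hBK'
    · have c := core4 B hB hBp (by linarith)
      have := mul_le_mul_of_nonneg_left (ga B (by linarith) (by linarith)) hβ0.le
      linarith
    · -- `B = K`: (Q2c)
      subst hBK'
      rw [hquK, zero_mul, sub_zero]
      obtain ⟨-, f1, -⟩ := phi B (by linarith) le_rfl
      have hBr : β * ((B : ℝ) - B₀) ≤ B := by
        have h0 : ((0 : ℝ) ≤ B₀) := by exact_mod_cast hB0
        have hBB : (0 : ℝ) ≤ (B : ℝ) - B₀ := by
          have : ((B₀ : ℝ) + 2 ≤ B) := by exact_mod_cast hB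
          linarith
        have := mul_le_mul_of_nonneg_right hβ1 hBB
        linarith
      have x1 : ρ * φ B ≤ ρ * B := mul_le_mul_of_nonneg_left (le_trans f1 hBr) hρ
      have e1 := eS B (by linarith) le_rfl
      have q3 := Q2c hBp
      have := mul_nonneg hβ0.le gprev
      linarith [x1, e1, q3]

end Summit.Ventures.LatticeQCDFlow.Scaling

end
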